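import Mathlib
import Summits.Ventures.PercRepro2.TypedPairHarris

/-!
# The three-point switching inequality (SW₃) (blind cell PercRepro2, p3 g9, 2026-08-26;
`proofs/P3-SWITCH.md` §4–§5)

On a three-point side with the state `σ x = (p~q, p~r, q~r)` (three Boolean connection bits, the
product order), the typed count of «`x` has exactly the connection `p~q`, `y` has exactly the
connection `p~r`» (with any nonnegative spectator weight `g (σ w)`) is at most the typed count of
«`x` has `p~q` and `p~r`, `y` has no connection» — the only two-term inequality of the three-point
side cone (P3-SWITCH §4), an instance of the box inequality `PairHarris.typedCount_box_le` with
`α = δ = (true, false, false)`, `β = γ = (false, true, false)`.  On realisable (transitive) states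
the right side reads «`x` connects all three points, `y` none».  Own work; standard axioms.
-/

namespace Summit.Ventures.PercRepro2

namespace CovForm

namespace PairHarris

open Classical

variable {E : Type*} [Fintype E] [DecidableEq E] {R : Type*} [Field R] [LinearOrder R]
  [IsStrictOrderedRing R]

/-- The box `α ≤ s ≤ α` is the point `s = α`. -/
lemma box_point_iff (s α : Bool × Bool × Bool) : (α ≤ s ∧ s ≤ α) ↔ s = α := by
  constructor
  · rintro ⟨h1, h2⟩; exact le_antisymm h2 h1
  · rintro rfl; exact ⟨le_rfl, le_rfl⟩

/-- `(t,f,f) ≤ s ∧ (f,t,f) ≤ s ↔ (t,t,f) ≤ s` on the three bits. -/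
lemma join_pq_pr_iff (s : Bool × Bool × Bool) :
    ((true, false, false) ≤ s ∧ (false, true, false) ≤ s) ↔ (true, true, false) ≤ s := by
  rcases s with ⟨a, b, c⟩
  cases a <;> cases b <;> cases c <;> decide

/-- `s ≤ (f,t,f) ∧ s ≤ (t,f,f) ↔ s = (f,f,f)` on the three bits. -/
lemma meet_pq_pr_iff (s : Bool × Bool × Bool) :
    (s ≤ (false, true, false) ∧ s ≤ (true, false, false)) ↔ s = (false, false, false) := by
  rcases s with ⟨a, b, c⟩
  cases a <;> cases b <;> cases c <;> decide

/-- **(SW₃)**: for a monotone three-bit state map `σ` and a nonnegative spectator function `g`,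
`typedCount (g(σ w) · 1[σ x = p~q only] · 1[σ y = p~r only]) ≤
 typedCount (g(σ w) · 1[(t,t,f) ≤ σ x] · 1[σ y = (f,f,f)])`. -/
theorem typedCount_switching_three (F : Finset E) (z : Config E) (τ : E → ℕ)
    (hτ : ∀ e ∈ F, τ e = 1 ∨ τ e = 2) (σ : Config E → Bool × Bool × Bool) (hσ : Monotone σ)
    (g : Bool × Bool × Bool → R) (hg : ∀ s, 0 ≤ g s) :
    typedCount F z τ (fun x y w => g (σ w) *
        ((if σ x = (true, false, false) then (1 : R) else 0) *
          (if σ y = (false, true, false) then (1 : R) else 0))) ≤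
      typedCount F z τ (fun x y w => g (σ w) *
        ((if (true, true, false) ≤ σ x then (1 : R) else 0) *
          (if σ y = (false, false, false) then (1 : R) else 0))) := by
  have h := typedCount_box_le (R := R) F z τ hτ σ hσ (true, false, false) (true, false, false)
    (false, true, false) (false, true, false) g hg
  refine le_trans (le_of_eq ?_) (h.trans (le_of_eq ?_))
  · congr 1
    funext x y w
    simp only [box_point_iff]
  · congr 1
    funext x y w
    simp only [join_pq_pr_iff, meet_pq_pr_iff]

end PairHarris

end CovForm

end Summit.Ventures.PercRepro2
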